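import Summits.ValiantsHypothesis.ValiantsHypothesis.Theorems.MonotoneRestorationOrbitRestorationQPTameStratum
import Summits.ValiantsHypothesis.ValiantsHypothesis.Theorems.MonotoneRestorationOrbitRestorationQPExplicitForm
import Summits.ValiantsHypothesis.ValiantsHypothesis.Theorems.MonotoneRestorationOrbitRestorationQPBoxVolumeMultiset
import HarnessLib

/-!
# Route MonotoneRestoration — crux `OrbitRestorationQP` (stmt-ValiantsHypothesis-18293), line `depth-three-rung`:
# `A_∞` REDUCED TO ITS WILD RESIDUE (reshape-ready, kernel-checked)

With the currency bridge (`ExplicitForm.sigmaPiSigmaValue_iff_explicit`), the tame stratum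
(`TameStratum.qpOrbitRestorable_of_tameTerms`: every term's factor multiset has quasi-polynomially many diagonal
translates) and the box-volume stratum (`DerivativeTower.boxVolume_restoration'`: total box volume
`Σ_i Π_{ℓ} (count ℓ + 1) ≤ n^c + c`, via the polynomial catalecticant) all landed, the open stub
`stub_sigmaPiSigmaValue` (A_∞) follows BY NAME from one per-level statement about the levels NOT covered by either
stratum.  This file proves that reduction:

* `qpOrbitRestorable_of_smallBox` — **the box-volume stratum PER LEVEL with a uniform constant**: for every `c`
  there is `c'` such that a matrix-symmetric `p` at level `n` with a depth-three representation of total box volume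
  `≤ n^c + c` is `QPOrbitRestorable c' n p` (singleton-family trick on the landed family-level theorem);
* the WILD RESIDUE is NOT a `def` (no vocabulary is introduced; the file is def-free); it is the hypothesis `hW` of
  `sigmaPiSigmaValue_of_wildResidue`, verbatim:
  for every `c` there is `c'` such that every `p` at level `n` which is matrix-symmetric, lies in
  `PDClass (fun _ => 1) n c`, and has NO depth-three representation `p = Σ_{i<k} C(a i) · Π (L i)` (affine
  factors) that is tame within budget `c` (all `|L i| ≤ n^c + c` and all `L i` with `≤ 2^((log₂ n + c)^c)`
  translates) and NONE of total box volume `≤ n^c + c`, is `QPOrbitRestorable c' n p`;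
* `sigmaPiSigmaValue_of_wildResidue` — **WILD RESIDUE ⇒ A_∞** (the registered stub, verbatim): at each level
  either a tame representation exists (tame stratum, constant `2c+7`), or a small-box one (box stratum), or the
  residue applies; `Restorable.qpOrbitRestorable_mono` merges the three constants.

So the exact remaining content of the rung is the WILD RESIDUE: levels at which the polynomial is depth-three-easy
but every cheap depth-three representation has a term whose factor multiset has super-quasi-polynomially many
diagonal translates AND super-polynomial box volume.  No example of such a matrix-symmetric family is known to
this file's author; neither is a proof.  Nothing here proves the stub; VP ≠ VNP is not touched. [folklore]

## References
* A. Dawar, G. Wilsenach, *Symmetric arithmetic circuits*, ToC 21 (2025), §3.3. [DawarWilsenach2025]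
-/

noncomputable section

open scoped Classical

-- `Summit.ValiantsHypothesis.ValiantsHypothesis.…` is the tree's single-conjunct layout (Sub = Summit).
set_option linter.dupNamespace false

namespace Summit.ValiantsHypothesis.ValiantsHypothesis.Theorems.OrbitRestorationQPDepthThreeRung

namespace Residue

open Literature.Computability.AlgebraicComplexity
open Equiv MvPolynomial

variable {n : ℕ}

/-! ### The box-volume stratum per level -/

/-- The singleton family `p, 0, 0, …` (`Function.update 0 n p`) at its own level. [folklore] -/
theorem single_self (n : ℕ) (p : MvPolynomial (Fin n × Fin n) ℂ) :
    Function.update (fun m => (0 : MvPolynomial (Fin m × Fin m) ℂ)) n p n = p := by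
  simp

/-- The singleton family elsewhere. [folklore] -/
theorem single_of_ne {n m : ℕ} (h : m ≠ n) (p : MvPolynomial (Fin n × Fin n) ℂ) :
    Function.update (fun m => (0 : MvPolynomial (Fin m × Fin m) ℂ)) n p m = 0 := by
  simp [Function.update_of_ne h]

/-- The singleton family of a matrix-symmetric polynomial is matrix-symmetric. [folklore] -/
theorem isMatrixSymmetric_single (n : ℕ) (p : MvPolynomial (Fin n × Fin n) ℂ)
    (hp : ∀ σ τ : Perm (Fin n), rename (fun q : Fin n × Fin n => (σ q.1, τ q.2)) p = p) :
    IsMatrixSymmetric (Function.update (fun m => (0 : MvPolynomial (Fin m × Fin m) ℂ)) n p) := by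
  intro m σ τ
  by_cases h : m = n
  · subst h
    rw [single_self]
    exact hp σ τ
  · rw [single_of_ne h, map_zero]

/-- **THE BOX-VOLUME STRATUM PER LEVEL (uniform constant).**  For every `c` there is `c'` such that a
matrix-symmetric `p` at level `n` with a representation `p = Σ_{i<k} C(a i) · Π (L i)`, affine factors, of total
box volume `Σ_i Π_{ℓ ∈ (L i).toFinset} (count ℓ + 1) ≤ n^c + c`, is `QPOrbitRestorable c' n p`.  (The landed
family-level theorem `DerivativeTower.boxVolume_restoration'` applied to the singleton family `p, 0, 0, …`.)
[folklore] -/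
theorem qpOrbitRestorable_of_smallBox (c : ℕ) : ∃ c' : ℕ, ∀ (n : ℕ) (p : MvPolynomial (Fin n × Fin n) ℂ),
    (∀ σ τ : Perm (Fin n), rename (fun q : Fin n × Fin n => (σ q.1, τ q.2)) p = p) →
    (∃ (k : ℕ) (a : Fin k → ℂ) (L : Fin k → Multiset (MvPolynomial (Fin n × Fin n) ℂ)),
      (∀ i, ∀ ℓ ∈ L i, ℓ.totalDegree ≤ 1) ∧
      (∑ i, ∏ ℓ ∈ (L i).toFinset, ((L i).count ℓ + 1)) ≤ n ^ c + c ∧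
      p = ∑ i, C (a i) * (L i).prod) →
    QPOrbitRestorable c' n p := by
  obtain ⟨c', hc'⟩ := DerivativeTower.boxVolume_restoration' c
  refine ⟨c', fun n p hp hrep => ?_⟩
  obtain ⟨k, a, L, hdeg, hvol, hpL⟩ := hrep
  have key := hc' (Function.update (fun m => (0 : MvPolynomial (Fin m × Fin m) ℂ)) n p)
    (isMatrixSymmetric_single n p hp) ?_ n
  · rwa [single_self] at key
  intro m
  by_cases h : m = n
  · subst h
    have hbox := fun i => DerivativeTower.exists_boxForm (L i) (hdeg i)
    choose t w b e hprod hcount using hbox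
    refine ⟨k, t, a, w, b, e, ?_, ?_⟩
    · calc (∑ i, ∏ j, (e i j + 1)) = ∑ i, ∏ ℓ ∈ (L i).toFinset, ((L i).count ℓ + 1) :=
            Finset.sum_congr rfl fun i _ => hcount i
        _ ≤ m ^ c + c := hvol
    · rw [single_self, hpL]
      exact Finset.sum_congr rfl fun i _ => by rw [hprod i]
  · refine ⟨0, Fin.elim0, Fin.elim0, fun i => Fin.elim0 i, fun i => Fin.elim0 i, fun i => Fin.elim0 i, ?_, ?_⟩
    · simp
    · rw [single_of_ne h]; simp

/-! ### The reduction -/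

/-- **WILD RESIDUE ⇒ `A_∞`.**  Suppose (hypothesis `hW`, the WILD RESIDUE) that for every `c` there is `c'` such
that every `p` at level `n` which is matrix-symmetric, lies in `PDClass (fun _ => 1) n c`, has NO tame depth-three
representation within budget `c` (`p = Σ_{i<k} C(a i) · Π (L i)`, affine factors, all `|L i| ≤ n^c + c`, every `L i`
with at most `2^((log₂ n + c)^c)` diagonal translates) and NO depth-three representation of total box volume
`≤ n^c + c`, is `QPOrbitRestorable c' n p`.  Then the registered stub `stub_sigmaPiSigmaValue` (conclusion, verbatim)
holds: the tame levels are settled by `TameStratum.qpOrbitRestorable_of_tameTerms`, the small-box levels by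
`qpOrbitRestorable_of_smallBox`, the rest by `hW`. [folklore] -/
theorem sigmaPiSigmaValue_of_wildResidue
    (hW : ∀ c : ℕ, ∃ c' : ℕ, ∀ (n : ℕ) (p : MvPolynomial (Fin n × Fin n) ℂ),
      (∀ σ τ : Perm (Fin n), rename (fun q : Fin n × Fin n => (σ q.1, τ q.2)) p = p) →
      PDClass (fun _ => 1) n c p →
      (¬ ∃ (k : ℕ) (a : Fin k → ℂ) (L : Fin k → Multiset (MvPolynomial (Fin n × Fin n) ℂ)),
          (∀ i, ∀ ℓ ∈ L i, ℓ.totalDegree ≤ 1) ∧ (∀ i, Multiset.card (L i) ≤ n ^ c + c) ∧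
          (∀ i, (Set.range fun σ : Perm (Fin n) => (L i).map (ren σ)).ncard ≤ 2 ^ ((Nat.log 2 n + c) ^ c)) ∧
          p = ∑ i, C (a i) * (L i).prod) →
      (¬ ∃ (k : ℕ) (a : Fin k → ℂ) (L : Fin k → Multiset (MvPolynomial (Fin n × Fin n) ℂ)),
          (∀ i, ∀ ℓ ∈ L i, ℓ.totalDegree ≤ 1) ∧
          (∑ i, ∏ ℓ ∈ (L i).toFinset, ((L i).count ℓ + 1)) ≤ n ^ c + c ∧
          p = ∑ i, C (a i) * (L i).prod) →
      QPOrbitRestorable c' n p) :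
    ∀ f : (n : ℕ) → MvPolynomial (Fin n × Fin n) ℂ, IsMatrixSymmetric f →
      (∃ c : ℕ, ∀ n : ℕ, PDClass (fun _ => 1) n c (f n)) →
      ∃ c : ℕ, ∀ n : ℕ, QPOrbitRestorable c n (f n) := by
  rintro f hsym ⟨c, hc⟩
  obtain ⟨cB, hB⟩ := qpOrbitRestorable_of_smallBox c
  obtain ⟨cW, hcW⟩ := hW c
  refine ⟨max (2 * c + 7) (max cB cW), fun n => ?_⟩
  have hsym_n : ∀ σ τ : Perm (Fin n), rename (fun q : Fin n × Fin n => (σ q.1, τ q.2)) (f n) = f n :=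
    fun σ τ => hsym n σ τ
  by_cases htame : ∃ (k : ℕ) (a : Fin k → ℂ) (L : Fin k → Multiset (MvPolynomial (Fin n × Fin n) ℂ)),
      (∀ i, ∀ ℓ ∈ L i, ℓ.totalDegree ≤ 1) ∧ (∀ i, Multiset.card (L i) ≤ n ^ c + c) ∧
      (∀ i, (Set.range fun σ : Perm (Fin n) => (L i).map (ren σ)).ncard ≤ 2 ^ ((Nat.log 2 n + c) ^ c)) ∧
      f n = ∑ i, C (a i) * (L i).prod
  · obtain ⟨k, a, L, hdeg, hcard, horb, hfn⟩ := htame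
    have hinv : ∀ σ : Perm (Fin n), ren σ (f n) = f n := fun σ => hsym n σ σ
    exact Restorable.qpOrbitRestorable_mono (le_max_left _ _)
      (TameStratum.qpOrbitRestorable_of_tameTerms c a L hdeg hcard horb hfn hinv)
  by_cases hbox : ∃ (k : ℕ) (a : Fin k → ℂ) (L : Fin k → Multiset (MvPolynomial (Fin n × Fin n) ℂ)),
      (∀ i, ∀ ℓ ∈ L i, ℓ.totalDegree ≤ 1) ∧
      (∑ i, ∏ ℓ ∈ (L i).toFinset, ((L i).count ℓ + 1)) ≤ n ^ c + c ∧
      f n = ∑ i, C (a i) * (L i).prod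
  · exact Restorable.qpOrbitRestorable_mono ((le_max_left _ _).trans (le_max_right _ _))
      (hB n (f n) hsym_n hbox)
  · exact Restorable.qpOrbitRestorable_mono ((le_max_right _ _).trans (le_max_right _ _))
      (hcW n (f n) hsym_n (hc n) htame hbox)

end Residue

end Summit.ValiantsHypothesis.ValiantsHypothesis.Theorems.OrbitRestorationQPDepthThreeRung

end
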